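import Mathlib
import Summits.CriticalPhenomena.PercolationContinuityZ3.Theorems.PercNearOneGluingNearOneGluingAttachRescueNegCorr
import Summits.CriticalPhenomena.PercolationContinuityZ3.Theorems.PercNearOneGluingNearOneGluingAttachAloneRescueBound
import Summits.CriticalPhenomena.PercolationContinuityZ3.Theorems.PercNearOneGluingNearOneGluingMaxattTwo
import Literature.Probability.LatticeModels.ProdBernoulliIndependence
import Literature.Probability.Percolation.Crossings
import Literature.Probability.Percolation.PercolationEvents
import HarnessLib

/-!
# Crux `PercNearOneGluing.NearOneGluing` (stmt-CriticalPhenomena-4574), line `SketchR2I5` — stub `stub_rescueTwo`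

Helper file for the crux (lead prover-line-stmt-CriticalPhenomena-4574-c4): the **two-relay
rescue inequality** of the `|A| = 3` case of the MAXATT / least-reliable-first gluing
inequality.  Proves exactly the registered stub signature; lands with
`--supports stmt-CriticalPhenomena-4574`.

## Content

Finite weighted graph on `Fin n`, `μ = prodBernoulli w` on bond configurations
`ω : Set (Sym2 (Fin n))`, target `b`, source `o`, two relays `y, z`, vertex sets `S, S'`.
Attachment events `Y = {o ↔ y inside S}`, `Zt = {o ↔ z inside S'}` (both increasing), rescue
events `f₁ = {z ↮ b} ∩ {y ↔ b}` and `f₂ = {y ↮ b} ∩ {z ↔ b}`.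
THEOREM (`stub_rescueTwo`): if `μ(z ↔ b) ≤ μ(y ↔ b)` then
**`μ(Zt ∩ f₁) + μ((Y ∖ Zt) ∩ f₂) ≤ μ(Zt) μ(f₁) + μ(Y ∖ Zt) μ(f₂)`.**

Proof.  Put `U = {y ↔ z}`, `D = Uᶜ`, `F = Y ∪ Zt`.  Then `f₁, f₂ ⊆ D` and `Y ∩ Zt ⊆ U`
(on `Y ∩ Zt`, `y ↔ o ↔ z`), so `(Y ∖ Zt) ∩ D = Y ∩ D`.
(a) van den Berg–Häggström–Kahn Thm. 1.5 for the pair `(y, z)` in the form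
`attachRescueNegCorr_twoCluster`: `μ(D) μ(Zt ∩ f₁) ≤ μ(f₁) μ(Zt ∩ D)`.
(b) `stub_attachAloneRescueBound`: `μ(D) μ((Y ∖ Zt) ∩ f₂) ≤ μ(Y ∩ D) μ(f₂)`.
If `μ(D) = 0` both `f`'s are null and the claim reads `0 ≤ …`.  Otherwise multiply the claim by
`μ(D) = 1 − μ(U)`; by (a), (b) it suffices that
`μ(f₁)[μ(Zt ∩ D) − μ(D)μ(Zt)] + μ(f₂)[μ(Y ∩ D) − μ(D)μ(Y) + μ(D)μ(Y ∩ Zt)] ≤ 0`.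
The first bracket is `−Cov(Zt, U) ≤ 0` (Harris), and `μ(f₁) ≥ μ(f₂)` (their difference is
`μ(y ↔ b) − μ(z ↔ b) ≥ 0`), so the left side is at most
`μ(f₂)[−Cov(Zt, U) − Cov(Y, U) + μ(D) μ(Y ∩ Zt)] = −μ(f₂) Cov(F, U) ≤ 0` (Harris for `F` and `U`;
the identity uses `μ(Y ∩ Zt ∩ U) = μ(Y ∩ Zt)`).
-/

namespace Summit.CriticalPhenomena.PercolationContinuityZ3.Theorems

open MeasureTheory Set Literature.Probability.LatticeModels Literature.Probability.Percolation
open scoped Classical BigOperators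

/-- **Real-arithmetic core of the two-relay rescue inequality.**  With `a₁ = μ(f₁) ≥ a₂ = μ(f₂) ≥ 0`,
`u = μ(U)`, `zt = μ(Zt)`, `yy = μ(Y)`, `yz = μ(Y ∩ Zt)`, `ztU = μ(Zt ∩ U)`, `yU = μ(Y ∩ U)`,
`FF = μ(Y ∪ Zt)`, `FU = μ((Y ∪ Zt) ∩ U)`, the two Harris inequalities `zt u ≤ ztU`, `FF u ≤ FU`
and inclusion–exclusion (`ztU + yU = FU + yz`, `zt + yy = FF + yz`):
`a₁ (zt − ztU) + a₂ (yy − yU) ≤ (1 − u) (zt a₁ + (yy − yz) a₂)`, since the difference of the two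
sides is `(a₁ − a₂)(ztU − zt u) + a₂ (FU − FF u) ≥ 0`. -/
private theorem rescueTwo_arith {a₁ a₂ u zt yy yz ztU yU FU FF : ℝ} (h₁ : a₂ ≤ a₁)
    (h₂ : 0 ≤ a₂) (hH1 : zt * u ≤ ztU) (hH2 : FF * u ≤ FU) (hid1 : ztU + yU = FU + yz)
    (hid2 : zt + yy = FF + yz) :
    a₁ * (zt - ztU) + a₂ * (yy - yU) ≤ (1 - u) * (zt * a₁ + (yy - yz) * a₂) := by
  have hyU : yU = FU + yz - ztU := by linarith
  have hyy : yy = FF + yz - zt := by linarith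
  subst hyU hyy
  nlinarith [mul_nonneg (sub_nonneg.2 h₁) (sub_nonneg.2 hH1), mul_nonneg h₂ (sub_nonneg.2 hH2)]

/-- **Two-relay rescue inequality.**  For `Y := openConnIn S o y`, `Zt := openConnIn S' o z`,
`f₁ := {z ↮ b} ∩ {y ↔ b}`, `f₂ := {y ↮ b} ∩ {z ↔ b}` and `μ(z ↔ b) ≤ μ(y ↔ b)`:
`μ(Zt ∩ f₁) + μ((Y ∖ Zt) ∩ f₂) ≤ μ(Zt) μ(f₁) + μ(Y ∖ Zt) μ(f₂)`.
From van den Berg–Häggström–Kahn (2006) Thm. 1.5 for the pair `(y, z)` twice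
(`attachRescueNegCorr_twoCluster`, `stub_attachAloneRescueBound`) and Harris' inequality for
`(Zt, {y ↔ z})` and `(Y ∪ Zt, {y ↔ z})`. -/
theorem stub_rescueTwo :
    ∀ (n : ℕ) (w : Sym2 (Fin n) → unitInterval) (S S' : Set (Fin n)) (o b y z : Fin n),
      (prodBernoulli w).real (openConn z b) ≤ (prodBernoulli w).real (openConn y b) →
      (prodBernoulli w).real (openConnIn S' o z ∩ ((openConn z b)ᶜ ∩ openConn y b)) +
          (prodBernoulli w).real ((openConnIn S o y \ openConnIn S' o z) ∩ ((openConn y b)ᶜ ∩ openConn z b)) ≤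
        (prodBernoulli w).real (openConnIn S' o z) * (prodBernoulli w).real ((openConn z b)ᶜ ∩ openConn y b) +
          (prodBernoulli w).real (openConnIn S o y \ openConnIn S' o z) *
            (prodBernoulli w).real ((openConn y b)ᶜ ∩ openConn z b) := by
  intro n w S S' o b y z hle
  have hm : ∀ E : Set (BondConfig (Fin n)), MeasurableSet E := fun _ => MeasurableSet.of_discrete
  rcases eq_or_ne y z with hyz | hyz
  · -- `y = z`: both rescue events are empty
    subst hyz
    simp only [Set.compl_inter_self, Set.inter_empty, measureReal_empty, mul_zero, add_zero,
      le_refl]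
  -- Harris for `(Zt, U)` and `(Y ∪ Zt, U)`, `U = {y ↔ z}`
  have hH1 : (prodBernoulli w).real (openConnIn S' o z) * (prodBernoulli w).real (openConn y z) ≤
      (prodBernoulli w).real (openConnIn S' o z ∩ openConn y z) :=
    prodBernoulli_harris w (isUpperSet_openConnIn S' o z) (isUpperSet_openConn y z) (hm _) (hm _)
  have hH2 : (prodBernoulli w).real (openConnIn S o y ∪ openConnIn S' o z) *
        (prodBernoulli w).real (openConn y z) ≤
      (prodBernoulli w).real ((openConnIn S o y ∪ openConnIn S' o z) ∩ openConn y z) :=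
    prodBernoulli_harris w ((isUpperSet_openConnIn S o y).union (isUpperSet_openConnIn S' o z))
      (isUpperSet_openConn y z) (hm _) (hm _)
  -- (a): BHK Thm. 1.5 for `(y, z)` with `Q = Zt`, `f = f₁`
  have ha := attachRescueNegCorr_twoCluster w y z b (openConnIn S' o z)
    (maxattTwo_openConnIn_mono_openEdgeCluster S' o z) hyz
  -- (b): the landed `stub_attachAloneRescueBound`
  have hb := stub_attachAloneRescueBound n w S S' o b y z
  rw [Set.inter_comm (openConn z b) (openConn y b)ᶜ] at hb
  -- `μ(f₂) ≤ μ(f₁)`: add `μ({y ↔ b} ∩ {z ↔ b})` to both sides of the hypothesis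
  have hf12 : (prodBernoulli w).real ((openConn y b)ᶜ ∩ openConn z b) ≤
      (prodBernoulli w).real ((openConn z b)ᶜ ∩ openConn y b) := by
    have h1 := measureReal_inter_add_sdiff (μ := prodBernoulli w) (s := openConn y b)
      (t := openConn z b) (hm _)
    have h2 := measureReal_inter_add_sdiff (μ := prodBernoulli w) (s := openConn z b)
      (t := openConn y b) (hm _)
    rw [Set.sdiff_eq, Set.inter_comm (openConn y b) (openConn z b)ᶜ] at h1
    rw [Set.sdiff_eq, Set.inter_comm (openConn z b) (openConn y b)ᶜ,
      Set.inter_comm (openConn z b) (openConn y b)] at h2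
    linarith
  -- notation
  set μ := prodBernoulli w with hμ
  set Y : Set (BondConfig (Fin n)) := openConnIn S o y with hY
  set Zt : Set (BondConfig (Fin n)) := openConnIn S' o z with hZt
  set U : Set (BondConfig (Fin n)) := openConn y z with hU
  set f₁ : Set (BondConfig (Fin n)) := (openConn z b)ᶜ ∩ openConn y b with hf₁
  set f₂ : Set (BondConfig (Fin n)) := (openConn y b)ᶜ ∩ openConn z b with hf₂
  -- pointwise facts: `f₁, f₂ ⊆ D = Uᶜ`, `Y ∩ Zt ⊆ U`, hence `(Y ∖ Zt) ∩ D = Y ∩ D`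
  have hf1D : f₁ ⊆ Uᶜ := by
    rintro ω ⟨h1, h2⟩ h3
    exact h1 (SimpleGraph.Reachable.trans (SimpleGraph.Reachable.symm h3) h2)
  have hf2D : f₂ ⊆ Uᶜ := by
    rintro ω ⟨h1, h2⟩ h3
    exact h1 (SimpleGraph.Reachable.trans h3 h2)
  have hYZU : Y ∩ Zt ⊆ U := by
    rintro ω ⟨hy', hz'⟩
    have hoy : (openGraph ω).Reachable o y := maxattTwo_openConn_of_openConnIn hy'
    have hoz : (openGraph ω).Reachable o z := maxattTwo_openConn_of_openConnIn hz'
    exact hoy.symm.trans hoz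
  have hYD : (Y \ Zt) ∩ Uᶜ = Y ∩ Uᶜ := by
    ext ω
    constructor
    · rintro ⟨⟨hy', -⟩, hd⟩
      exact ⟨hy', hd⟩
    · rintro ⟨hy', hd⟩
      exact ⟨⟨hy', fun hz' => hd (hYZU ⟨hy', hz'⟩)⟩, hd⟩
  -- measure bookkeeping
  have hsplit : ∀ A B : Set (BondConfig (Fin n)), μ.real (A ∩ Bᶜ) = μ.real A - μ.real (A ∩ B) := by
    intro A B
    have h := measureReal_inter_add_sdiff (μ := μ) (s := A) (t := B) (hm B)
    rw [Set.sdiff_eq] at h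
    linarith
  have hDU : μ.real Uᶜ = 1 - μ.real U := probReal_compl_eq_one_sub (hm U)
  have hZtD : μ.real (Zt ∩ Uᶜ) = μ.real Zt - μ.real (Zt ∩ U) := hsplit Zt U
  have hYDm : μ.real (Y ∩ Uᶜ) = μ.real Y - μ.real (Y ∩ U) := hsplit Y U
  have hYZt : μ.real (Y \ Zt) = μ.real Y - μ.real (Y ∩ Zt) := by
    have h := measureReal_inter_add_sdiff (μ := μ) (s := Y) (t := Zt) (hm Zt)
    linarith
  have hid1 : μ.real (Zt ∩ U) + μ.real (Y ∩ U) = μ.real ((Y ∪ Zt) ∩ U) + μ.real (Y ∩ Zt) := by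
    have h := measureReal_union_add_inter (μ := μ) (s := Y ∩ U) (t := Zt ∩ U) (hm _)
    rw [← Set.union_inter_distrib_right Y Zt U, Set.inter_inter_inter_comm Y U Zt U,
      Set.inter_self U, Set.inter_eq_left.2 hYZU] at h
    linarith
  have hid2 : μ.real Zt + μ.real Y = μ.real (Y ∪ Zt) + μ.real (Y ∩ Zt) := by
    have h := measureReal_union_add_inter (μ := μ) (s := Y) (t := Zt) (hm _)
    linarith
  -- trivial bounds
  have ha1D : μ.real f₁ ≤ μ.real Uᶜ := measureReal_mono hf1D
  have ha2D : μ.real f₂ ≤ μ.real Uᶜ := measureReal_mono hf2D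
  have hm1 : μ.real (Zt ∩ f₁) ≤ μ.real f₁ := measureReal_mono Set.inter_subset_right
  have hm2 : μ.real ((Y \ Zt) ∩ f₂) ≤ μ.real f₂ := measureReal_mono Set.inter_subset_right
  rcases (measureReal_nonneg (μ := μ) (s := Uᶜ)).eq_or_lt with hD0 | hDpos
  · -- `μ(D) = 0`: both rescue events are null
    have e1 : μ.real (Zt ∩ f₁) = 0 := le_antisymm (by linarith) measureReal_nonneg
    have e2 : μ.real ((Y \ Zt) ∩ f₂) = 0 := le_antisymm (by linarith) measureReal_nonneg
    rw [e1, e2, add_zero]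
    exact add_nonneg (mul_nonneg measureReal_nonneg measureReal_nonneg)
      (mul_nonneg measureReal_nonneg measureReal_nonneg)
  · -- `μ(D) > 0`: multiply the claim by `μ(D)` and use (a), (b), Harris twice
    rw [Set.inter_eq_right.2 hf1D, Set.inter_eq_right.2 (Set.inter_subset_left.trans hf1D),
      hsplit Uᶜ Zt, hsplit f₁ Zt, Set.inter_comm Uᶜ Zt, Set.inter_comm f₁ Zt, hZtD] at ha
    -- `ha : μ f₁ * (μ D - (μ Zt - μ (Zt ∩ U))) ≤ μ D * (μ f₁ - μ (Zt ∩ f₁))`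
    rw [hYD, hYDm] at hb
    -- `hb : μ D * μ ((Y ∖ Zt) ∩ f₂) ≤ (μ Y - μ (Y ∩ U)) * μ f₂`
    have harith := rescueTwo_arith hf12 measureReal_nonneg hH1 hH2 hid1 hid2
    have step : μ.real Uᶜ * (μ.real (Zt ∩ f₁) + μ.real ((Y \ Zt) ∩ f₂)) ≤
        μ.real Uᶜ * (μ.real Zt * μ.real f₁ + μ.real (Y \ Zt) * μ.real f₂) := by
      rw [hYZt, hDU]
      rw [hDU] at ha hb
      nlinarith [ha, hb, harith]
    exact le_of_mul_le_mul_left step hDpos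

end Summit.CriticalPhenomena.PercolationContinuityZ3.Theorems
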